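import Mathlib.Algebra.GroupWithZero.Subgroup
import Summits.ABC.IUTFork.Joshi.LogShellsJoshi
import HarnessLib

/-!
# Joshi's log-shells I, supplement ([J-III] arXiv:2401.13508 v4, Def. 9.2.1.1, (9.2.1.3), (9.4.1.3)): the log-shell as a
# `ℤ_p`-MODULE (additive subgroup of `L_v`) and the «span of the shell» property — TYPED/DERIVED, no side taken

Record file of the abc-iut cell, branch E (rung LADDER-ABC:A2.E; seat abc-iut-E-t19, slot T-19 supplement; parent
`Joshi/LogShellsJoshi.lean` p429212). Source: K. Joshi, *Construction of Arithmetic Teichmuller Spaces III*, «Preliminary version for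
comments», arXiv:2401.13508 v4 = bib `Joshi2024ATS3`; «p. N l. a–b» = PDF page N of the render `HOME/lit/renders/Joshi-arxiv-2401.13508/`.
UNREFEREED preprint, rejected by the IUT author [Mochizuki2024JoshiReport]; TYPED AS A CANDIDATE (D-0012): typed ≠ proved ≠ endorsed;
nothing here asserts abc, [IUTchIII] Cor. 3.12, or any claim of [J-III].

* Def. 9.2.1.1 (p. 96 l. 37–38) calls `I((X/L_v, X^an/K_v))` «the `ℤ_p`-module given as follows»: the parent file typed the SET
  `mochizukiLogShell p L_v = (1/p*)·log_p(𝒪^×)`; here its additive-group structure is recorded — `mochizukiLogShellAddSubgroup p L_v`,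
  the pointwise `(p*)⁻¹`-multiple of OUR `Literature.IUT.LogVolume.logUnitsAddSubgroup p L_v` ([IUTchIV] Prop. 1.2: «the submodule
  `log_p(R^×)`»), with carrier PROVED equal to `mochizukiLogShell p L_v` (the `ℤ_p`-scalar action itself is not recorded, as in
  the Literature parent).
* (9.2.1.3) / (9.4.1.3) (p. 96 l. 51–52; p. 100 l. 52–53: «`𝓘^{ℚ_p}_p(L′)` is the `ℚ_p`-vector space generated by each direct summand of
  `𝓘_p(L′)`»): the parent PROVED `Submodule.span ℚ_[p] I = ⊤`; here also the `ℚ`-span: `Submodule.span ℚ I = ⊤` in `L_v`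
  (`span_rat_mochizukiLogShell_eq_top`: a `ℤ_p`-lattice spans `L_v` already over `ℚ = ℤ[1/p] ∩ …`, since `p⁻ⁿ·𝒪 ↗ L_v`). This is
  the shape in which slot T-20's tensor-packet carrier (`Joshi/TensorPacketsJoshi.lean`, p429434) consumes the log-shells: its NAMED
  property `TensorPacketDatum.IsSpanOfShell 𝕜 IQ I := ∀ y w, Submodule.span 𝕜 (I y w) = ⊤` holds, at `𝕜 = ℚ` and `𝕜 = ℚ_{p_w}`, for the
  model family `IQ y w := L_w`, `I y w := mochizukiLogShellAddSubgroup p_w L_w` — `isSpanOfShell_rat_family`,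
  `isSpanOfShell_padic` (stated in that shape WITHOUT importing T-20's file: merge-debt reconciliation is one `fun y w => …` away).

OUR nearest objects: `Literature.IUT.LogVolume.logUnitsAddSubgroup`, `Literature.AnabelianGeometry.AbsoluteAnabelian.logShell`;
`Summit.ABC.IUTFork.Thm311.LogShells.carrier v` (the `ℚ`-structure «`I^ℚ`», bound in `Joshi/DictionaryLogShells.lean`, row D-08b
`CarrierSpanned`). NOT here: topologies, compactness of `I` (`Literature.IUT.LogThetaLattice.isCompact_logShell`), any judgement.
[claim: Joshi2024ATS3, status: disputed]
-/

set_option autoImplicit false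

noncomputable section

open Set Metric
open scoped Pointwise

namespace Summit.ABC.IUTFork.Joshi

open Literature.IUT.LogVolume Literature.AnabelianGeometry.AbsoluteAnabelian Literature.NumberTheory.Transcendental

section Lattice

variable (p : ℕ) [Fact p.Prime] (Lv : Type*) [NontriviallyNormedField Lv] [NormedAlgebra ℚ_[p] Lv] [IsUltrametricDist Lv]
  [ProperSpace Lv]

/-- **Def. 9.2.1.1, «the `ℤ_p`-module»** (p. 96 l. 37–50): `I((X/L_v, X^an/K_v)) = (1/p*)·log(𝒪^*_{L_v})` as an ADDITIVE SUBGROUP of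
`L_v` — the pointwise `(p*)⁻¹`-multiple (`p* = p` resp. `4`) of OUR `logUnitsAddSubgroup p L_v = log_p(𝒪^×)`.
[claim: Joshi2024ATS3, status: disputed] -/
def mochizukiLogShellAddSubgroup : AddSubgroup Lv :=
  ((p ^ (if p = 2 then 2 else 1) : ℕ) : Lv)⁻¹ • logUnitsAddSubgroup p Lv

/-- Its carrier is the typed set `mochizukiLogShell p L_v` of the parent file. DERIVED. [claim: Joshi2024ATS3, status: disputed] -/
theorem coe_mochizukiLogShellAddSubgroup :
    (mochizukiLogShellAddSubgroup p Lv : Set Lv) = mochizukiLogShell p Lv := by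
  rw [mochizukiLogShell_eq_logShell, logShell_ofUnitLog, mochizukiLogShellAddSubgroup, AddSubgroup.coe_pointwise_smul,
    coe_logUnitsAddSubgroup]

/-- Membership: `x ∈ I` as a subgroup iff `x ∈ mochizukiLogShell p L_v`. [claim: Joshi2024ATS3, status: disputed] -/
theorem mem_mochizukiLogShellAddSubgroup_iff (x : Lv) :
    x ∈ mochizukiLogShellAddSubgroup p Lv ↔ x ∈ mochizukiLogShell p Lv := by
  rw [← SetLike.mem_coe, coe_mochizukiLogShellAddSubgroup]

/-- `I` is closed under addition and negation and contains `0` (it is a `ℤ_p`-module in print; here: an additive group) — e.g.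
`𝒪_{L_v} ⊆ I` as subgroups' carriers. DERIVED. [claim: Joshi2024ATS3, status: disputed] -/
theorem closedBall_subset_coe_mochizukiLogShellAddSubgroup :
    closedBall (0 : Lv) 1 ⊆ (mochizukiLogShellAddSubgroup p Lv : Set Lv) := by
  rw [coe_mochizukiLogShellAddSubgroup]; exact closedBall_subset_mochizukiLogShell p Lv

end Lattice

section RatSpan

variable (p : ℕ) [Fact p.Prime] (Lv : Type*) [NontriviallyNormedField Lv] [NormedAlgebra ℚ_[p] Lv] [IsUltrametricDist Lv]
  [CompleteSpace Lv]

/-- **(9.2.1.3)/(9.4.1.3) over `ℚ`**: the `ℚ`-span of `I((X/L_v, X^an/K_v))` inside `L_v` is all of `L_v` (for `x ∈ L_v`, `pⁿ·x ∈ 𝒪 ⊆ I`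
for `n ≫ 0` and `x = p⁻ⁿ·(pⁿ·x)` with `p⁻ⁿ ∈ ℚ`). This is the «`I^ℚ`» reading used by OUR `ℚ`-carriers (`Thm311.LogShells.carrier`).
DERIVED. [claim: Joshi2024ATS3, status: disputed] -/
theorem span_rat_mochizukiLogShell_eq_top [CharZero Lv] : Submodule.span ℚ (mochizukiLogShell p Lv) = ⊤ := by
  refine Submodule.eq_top_iff'.2 fun x => ?_
  have hp1 : (1 : ℝ) < p := by exact_mod_cast (Fact.out : p.Prime).one_lt
  have hnp : ‖(p : Lv)‖ = (p : ℝ)⁻¹ := by rw [IwasawaLog.norm_natCast p (F := Lv) p, Padic.norm_p]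
  have hlt : ‖(p : Lv)‖ < 1 := by rw [hnp]; exact inv_lt_one_of_one_lt₀ hp1
  obtain ⟨n, hn⟩ := exists_pow_lt_of_lt_one (show (0 : ℝ) < 1 / (‖x‖ + 1) by positivity) hlt
  have hn' : ‖(p : Lv)‖ ^ n * ‖x‖ ≤ 1 := by
    calc ‖(p : Lv)‖ ^ n * ‖x‖ ≤ (1 / (‖x‖ + 1)) * (‖x‖ + 1) := by gcongr; linarith
      _ = 1 := by field_simp
  have hc : ((p : ℚ) ^ n) ≠ 0 := pow_ne_zero _ (by exact_mod_cast (Fact.out : p.Prime).ne_zero)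
  have hmem : ((p : ℚ) ^ n) • x ∈ Submodule.span ℚ (mochizukiLogShell p Lv) := by
    refine Submodule.subset_span (closedBall_subset_mochizukiLogShell p Lv ?_)
    rw [mem_closedBall, dist_zero_right, Rat.smul_def, Rat.cast_pow, Rat.cast_natCast, norm_mul, norm_pow]
    exact hn'
  exact (Submodule.smul_mem_iff _ hc).1 hmem

end RatSpan

section SpanOfShellFamily

variable {V : Type*} (pOf : V → ℕ) [∀ w, Fact (pOf w).Prime] (Lv : V → Type*) [∀ w, NontriviallyNormedField (Lv w)]
  [∀ w, NormedAlgebra ℚ_[pOf w] (Lv w)] [∀ w, IsUltrametricDist (Lv w)] [∀ w, ProperSpace (Lv w)]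

/-- **The «span of the shell» property of (9.4.1.3) for the MODEL FAMILY**, `ℚ`-version: for every arithmeticoid index `y` and place `w`,
`Submodule.span ℚ (I_w) = ⊤` in `L_w` — literally the shape of slot T-20's `TensorPacketDatum.IsSpanOfShell ℚ (fun _ w => L_w)
(fun _ w => mochizukiLogShellAddSubgroup p_w L_w)` (merge-debt E-t19 ↔ E-t20: instantiate by `fun _ w => isSpanOfShell_rat_family … w`).
DERIVED. [claim: Joshi2024ATS3, status: disputed] -/
theorem isSpanOfShell_rat_family [∀ w, CharZero (Lv w)] (w : V) :
    Submodule.span ℚ (mochizukiLogShellAddSubgroup (pOf w) (Lv w) : Set (Lv w)) = ⊤ := by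
  rw [coe_mochizukiLogShellAddSubgroup]; exact span_rat_mochizukiLogShell_eq_top (pOf w) (Lv w)

/-- The same property over `ℚ_{p_w}` at each place (the parent's `mochizukiLogShellQ_eq_top`, in subgroup clothing).
DERIVED. [claim: Joshi2024ATS3, status: disputed] -/
theorem isSpanOfShell_padic (w : V) :
    Submodule.span ℚ_[pOf w] (mochizukiLogShellAddSubgroup (pOf w) (Lv w) : Set (Lv w)) = ⊤ := by
  rw [coe_mochizukiLogShellAddSubgroup]; exact mochizukiLogShellQ_eq_top (pOf w) (Lv w)

end SpanOfShellFamily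

end Summit.ABC.IUTFork.Joshi

end
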